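import Summits.QuantumFields.BalabanUV.T4Continuum.E3Cert.ZL2d4C0half.D_zL2d4C0half_b0_g0
import Summits.QuantumFields.BalabanUV.T4Continuum.E3Cert.ZL2d4C0half.D_zL2d4C0half_b0_l0
import Summits.QuantumFields.BalabanUV.T4Continuum.E3Cert.ZL2d4C0half.D_zL2d4C0half_b0_g1
import Summits.QuantumFields.BalabanUV.T4Continuum.E3Cert.ZL2d4C0half.D_zL2d4C0half_b0_l1
import Summits.QuantumFields.BalabanUV.T4Continuum.E3Cert.ZL2d4C0half.D_zL2d4C0half_b0_g2
import Summits.QuantumFields.BalabanUV.T4Continuum.E3Cert.ZL2d4C0half.D_zL2d4C0half_b0_l2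
import Summits.QuantumFields.BalabanUV.T4Continuum.E3Cert.E3PolyCertZ
/-! E3 certificate package `ZL2d4C0half` — module `D_b0` ((4,2,1) block, d = 4, L = 2, type A small-field hypothesis c₀ = ½ ((x_t)₀ ≥ ½ on every link), γ = 923∕1024, M = 2²¹; emitter `bal_e3_lean_emit.py` output for
`block-L2d4-su2-c0half-dyadic.json`, lane `run/shared/lean/ttrl/balaban-calc/e3/lean-draft/tree/zL2d4C0half/D_b0.lean`; TREE COPY by the substrate cell (seat p3), typer
rulings (μ3)∕(ν2) = FINAL (μ6), journal l.19196 ∕ l.20020, following the E3 PILOT's scripted road (`substrate/p3/E3-PILOT.md` §1): import prefix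
substituted and one-line docstrings added BY SCRIPT, no literal touched).  Meaning of the certificate: see `Data.lean` ∕ `Main.lean` of this package
and the checker `E3Cert/E3PolyCertZ*.lean`.  HONEST: certified computation on ONE small block — NOT Prop. (1.8), NOT an input of any NE row today,
NOT infinite volume ∕ mass gap ∕ Clay. -/
set_option maxRecDepth 200000
set_option maxHeartbeats 0
namespace E3Z
/-- E3 certificate `zL2d4C0half` component: `zL2d4C0half_b0` (lane output, transcribed verbatim; see the module docstring). -/
def zL2d4C0half_b0 : GramBlock := { rows := [(0,0),(0,1),(0,2),(0,3),(0,4),(0,5),(0,6),(0,7),(0,8),(0,9),(0,10),(0,11),(0,12),(0,13),(0,14),(0,15),(0,16),(0,17),(0,18),(0,19),(0,20),(0,21),(0,22),(0,23),(0,24),(0,25),(0,26),(0,27),(0,28),(0,29),(0,30),(0,31),(0,32),(0,33),(0,34),(0,35),(0,36),(0,37),(0,38),(0,39),(0,40),(0,41),(0,42),(0,43),(0,44),(0,45),(0,46),(0,47),(0,48),(0,49),(0,50),(0,51),(0,52),(0,53),(0,54),(0,55),(0,56),(0,57),(0,58),(0,59),(0,60),(0,61),(0,62),(0,63)], gden :=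 2097152, gnum := zL2d4C0half_b0_g0 ++ zL2d4C0half_b0_g1 ++ zL2d4C0half_b0_g2, lden := 24, lnum := zL2d4C0half_b0_l0 ++ zL2d4C0half_b0_l1 ++ zL2d4C0half_b0_l2 }
end E3Z
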